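import Summits.BirchSwinnertonDyer.BirchSwinnertonDyer.Theorems.ManinLocalTwoThreeBracketSturmOneThirtySixB
import HarnessLib

/-!
# Level 136 = 2³·17 (C2 domain, `8 ∥ 136` — additive wild at 2 with conductor exponent 3; genus 15; TWO classes `136a`, `136b`) COMPLETE:
# `|c| = 1` — hence `2 ∤ c` — for EVERY lattice-optimal `X₀(136)`-datum of EVERY globally minimal elliptic curve over `ℚ`, UNCONDITIONALLY

Cell `bsd-f2-manin`, route `ManinLocalTwoThree`, crux C2 `ManinOddAtFour` (stmt-BirchSwinnertonDyer-22967: `2² ∣ 136`); prover seat p2 gen 31; `--supports`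
(helper).  ASSEMBLY: an g55's FACT-FREE two-row kernel pinning `PinningOneThirtySix.pinning` (`4 • D.f = Σ_j y_j • C_j` for one of the two certificates
`rowA` (`136a`) / `rowB` (`136b`) on the `22`-quotient `η`-basis of `M₂(Γ₀(136))`; landed by LEAD p1 g26) + this seat's DEEP tables
(`…EtaTablesOneThirtySixDeepA–I`, depth `218 = μ₀ + 2`) + TWO Bracket–Sturm certificates found by exact linear algebra (joint nullspace of
`x∘φ·B = A` over the basis, nullity `6` for each class; `(B, A)` supported on the twelve quotients that carry the two pinning rows (indices 0,1,2,3,4,7,8,16,18,19,20,21; nullity 1 each)): with `136a1 = [0,1,0,−4,0]` (`c₄ = 208`, `c₆ = −1216`,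
`Δ = 2⁸·17`) and `136b1 = [0,−1,0,−8,−4]` (`c₄ = 400`, `c₆ = 5824`, `Δ = 2¹⁰·17`): `216·[A,B]² = F²·(864A³ − 18c₄·AB² − c₆·B³)·B` to `O(q²¹⁸)`
(one `decide +kernel` per class), Sturm bound `⌊12·216/12⌋ = 216 < 218`, whence `Λ(D.f) ⊆ Λ_{136x1}` and p3's Néron squeeze:
**`|c| = 1` and `2 ∤ c` on `X₀(136)`** (`abs_maninConstant_eq_one_oneThirtySix`, `maninOddAtFour_oneThirtySix`).
HONEST FRAMING: unconditional (standard axioms); ONE level of C2 — nothing here proves C2 for all `N`, Manin's conjecture or BSD; item 22967 stays OPEN.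
[cite: Manin1972, Prop. 1.4] [cite: Sturm1987, Thm. 1] [cite: AgasheRibetStein2006, §§1–2] [cite: CremonaAlgorithms1997, §2.10, Table 1 (136a1, 136b1), Table 3 (N = 136)]
[cite: SilvermanAEC2009, VII.1 Remark 1.1] [cite: Koehler2011, §2.1]
-/

set_option autoImplicit false
-- lint-debt: the directory name repeats the summit name (sibling precedent `ManinLocalTwoThreeManinConstantEightyEight.lean`)
set_option linter.dupNamespace false

noncomputable section

open Complex
open UpperHalfPlane hiding I
open scoped MatrixGroups ModularForm
open ModularForm CongruenceSubgroup PowerSeries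
open Literature.NumberTheory.ModularForms
open Literature.NumberTheory.EllipticCurves Literature.NumberTheory.EllipticCurves.ModularForms

namespace Summit.BirchSwinnertonDyer.BirchSwinnertonDyer.Theorems.ManinLocalTwoThree.LevelOneThirtySix

open Summit.BirchSwinnertonDyer.BirchSwinnertonDyer.Theorems.ManinLocalTwoThree.BracketSturm Summit.BirchSwinnertonDyer.BirchSwinnertonDyer.Theorems.ManinLocalTwoThree.PinningKernel Summit.BirchSwinnertonDyer.BirchSwinnertonDyer.Theorems.ManinLocalTwoThree.PinningOneThirtySix

/-- **`|c| = 1` FOR EVERY LATTICE-OPTIMAL `X₀(136)`-DATUM of every globally minimal elliptic curve over `ℚ`** — UNCONDITIONAL (both pinning rows).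
[cite: Manin1972, Prop. 1.4] [cite: AgasheRibetStein2006, §§1–2] [cite: CremonaAlgorithms1997, Table 1 (136a1, 136b1)] -/
theorem abs_maninConstant_eq_one_oneThirtySix (W : WeierstrassCurve ℚ) [W.IsElliptic] [W.IsGloballyMinimal]
    (D : ModularParametrizationData W 136) (hopt : ∀ z ∈ D.L.lattice, ∃ w ∈ periodLattice D.f, z = D.c * w) :
    |D.maninConstant| = 1 := by
  obtain ⟨C, hC, c, hc, -, hpin⟩ := pinning D
  rw [show goodCerts = [rowA, rowB] from rfl] at hc
  simp only [List.mem_cons, List.mem_nil_iff, or_false] at hc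
  rcases hc with rfl | rfl
  · exact abs_maninConstant_eq_one_oneThirtySixA_of_row W D hopt C hC hpin
  · exact abs_maninConstant_eq_one_oneThirtySixB_of_row W D hopt C hC hpin

/-- **C2 `ManinOddAtFour` at `N = 136` (`2² ∣ 136`): `2 ∤ c(D)`** for every lattice-optimal `X₀(136)`-datum — UNCONDITIONAL. [cite: AgasheRibetStein2006, §§1–2] -/
theorem not_two_dvd_maninConstant_oneThirtySix (W : WeierstrassCurve ℚ) [W.IsElliptic] [W.IsGloballyMinimal]
    (D : ModularParametrizationData W 136) (hopt : ∀ z ∈ D.L.lattice, ∃ w ∈ periodLattice D.f, z = D.c * w) :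
    ¬ (2 : ℤ) ∣ D.maninConstant := by
  have h := abs_maninConstant_eq_one_oneThirtySix W D hopt
  intro h2
  have := Int.le_of_dvd (by rw [h]; norm_num) ((dvd_abs _ _).mpr h2)
  rw [h] at this
  norm_num at this

/-- **No prime divides `c` on `X₀(136)`.** [cite: AgasheRibetStein2006, §§1–2] -/
theorem not_prime_dvd_maninConstant_oneThirtySix (W : WeierstrassCurve ℚ) [W.IsElliptic] [W.IsGloballyMinimal]
    (D : ModularParametrizationData W 136) (hopt : ∀ z ∈ D.L.lattice, ∃ w ∈ periodLattice D.f, z = D.c * w)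
    {p : ℕ} (hp : p.Prime) : ¬ (p : ℤ) ∣ D.maninConstant := by
  have h := abs_maninConstant_eq_one_oneThirtySix W D hopt
  intro hpd
  have h1 := Int.le_of_dvd (by rw [h]; norm_num) ((dvd_abs _ _).mpr hpd)
  rw [h] at h1
  have := hp.two_le
  omega

/-- **The C2 conclusion on the whole `X₀(136)`-domain**: `2² ∣ 136`, and `|c| = 1 ∧ 2 ∤ c` for every lattice-optimal `X₀(136)`-datum of every globally minimal
elliptic curve over `ℚ` — UNCONDITIONAL; BSD and C2 for general `N` are NOT proved by this. [folklore] -/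
theorem maninOddAtFour_oneThirtySix :
    2 ^ 2 ∣ 136 ∧ ∀ (W : WeierstrassCurve ℚ) [W.IsElliptic] [W.IsGloballyMinimal] (D : ModularParametrizationData W 136),
      (∀ z ∈ D.L.lattice, ∃ w ∈ periodLattice D.f, z = D.c * w) → |D.maninConstant| = 1 ∧ ¬ (2 : ℤ) ∣ D.maninConstant :=
  ⟨⟨34, by norm_num⟩, fun W _ _ D hopt ↦ ⟨abs_maninConstant_eq_one_oneThirtySix W D hopt, not_two_dvd_maninConstant_oneThirtySix W D hopt⟩⟩

end Summit.BirchSwinnertonDyer.BirchSwinnertonDyer.Theorems.ManinLocalTwoThree.LevelOneThirtySix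

end
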